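import Summits.BirchSwinnertonDyer.BirchSwinnertonDyer.Theorems.ByReductionTypeAtTwoAdditivePotMultConjATwoNarrowTwo10904Class
import Summits.BirchSwinnertonDyer.BirchSwinnertonDyer.Theorems.ByReductionTypeAtTwoAdditivePotMultConjATwoNarrowRoadKitReal
import HarnessLib

/-!
# C4″ `AdditivePotMultOverKAtTwo` (item stmt-BirchSwinnertonDyer-22618), the (I1M′) input of the upper half on the `0 < Δ` rows:
# LAYER-TWO NARROW CERTIFICATE `d = 10904`, part FIELD — the cubic field of discriminant `10904` (`X³ + (0)X² + (-17)X + (-18)`): three located real embeddings,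
# TOTAL REALITY, odd class number at `ℚ(θ)`, and the one bit `2 ∤ h(ℚ(θ,√2))` by Chevalley's door at `2` (KERNEL; rows 196272s1)

Cell `bsd-2adic`, rung K4, seat `bsd-2adic-k4-w3` GEN 13 (explicit unit of director-bsd g16 (309)(7); `--supports stmt-BirchSwinnertonDyer-22618`).
HONEST FRAMING (D-0036/D-0054/D-0152): THEOREMS ONLY (no definition, no named fact, no `sorry`, no instance). The series `…NarrowTwo10904{Class, Field,
Dyadic, Residues, TotPos, Integers, Parity, SignsA/B/C, Units, Rows}` carries k4-w1 GEN 11's zero-hypothesis LAYER-TWO narrow certificate (row `261648q1`,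
`…NarrowRankCertificate316*`: `h(A₁)`, `h(A₂)` odd by genus theory with one dyadic non-norm unit, ONE totally positive non-square unit of `A₁ = ℚ(θ,√2)`,
ELEVEN sign-independent units of `A₂ = ℚ(θ,√(2+√2))`, k4-w2's Edgar–Mollin–Peterson door `a = 1, b = 11`, cruxlead-19573-w2's rung `m = 1`) to the
totally real cubic `2`-torsion field of discriminant `10904` (`X³ + (0)X² + (-17)X + (-18)`) of the C4″ census rows 196272s1 (eng-2 CERT-ADD-POTMULT-POS81-AB-E2:
`n₀ = 0`, `rank₂ Cl⁺ = [0,1,1]`, unit signature ranks `[3,5,11]`, `h = 1` at layers `0,1,2` — letter NARROW-EQUAL12, instrument grade `grh`; here KERNEL).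
All certificates were found by the seat's exact-arithmetic tools (`k4w3/gen13/tools`: GEN 12 `narrowcert/unitlib` + layer-two arithmetic `nf12/cert2`) and are CHECKED
HERE by the kernel. Statement (A) is NOT BSD: BSD₂ for these curves is not proved; C4″ / (I1M′) stay research-open; nothing booked; no row of 22618 changes tier
(pen RC-490 (4)); BSD is not proved by any of this.

References: [CoatesSujatha2005] Conj. A, Thm. 3.4; [Fukuda1994] Thm. 1 (2); [EdgarMollinPeterson1986] Thm. 2.1; [FrohlichTaylor1990] Ch. V §1 (1.8)–(1.13);
[Lang1990] Ch. 13 §4 Lemma 4.1; [Washington1997] §13.1, Prop. 13.2; [Cohen1993] §4.1.3, §6.3; [Marcus1977] Ch. 5 Thm. 22, 35–37; [Omeara1963] §63.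
-/

set_option autoImplicit false
-- sibling precedent (`…NarrowStampsAClass.lean`): the directory name repeats the summit name
set_option linter.dupNamespace false

noncomputable section

open scoped Classical IntermediateField NumberField

namespace Summit.BirchSwinnertonDyer.BirchSwinnertonDyer.Theorems.AddKatoTwo

open WeierstrassCurve Field Polynomial IsDedekindDomain NumberField IntermediateField Literature.NumberTheory.EllipticCurves
  Literature.NumberTheory.EllipticCurves.ZpExtension
  Literature.NumberTheory.GaloisRepresentations Literature.NumberTheory.IwasawaTheory Literature.NumberTheory.NumberFields
  Literature.Geometry.Kaehler.ComplexTorus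
  Summit.BirchSwinnertonDyer.BirchSwinnertonDyer.Theorems.AlignedTransportAtTwoTorsionPointField
  Summit.BirchSwinnertonDyer.BirchSwinnertonDyer.Theorems.SteinbergFibreAtTwo.NarrowRankCert

/-! ## Real embeddings of `ℚ(θ)`, `θ³ + (0)θ² + (-17)θ + (-18) = 0` (totally real, `d = 10904`) -/

section Embeddings

variable {θ : AlgebraicClosure ℚ}

/-- The cubic relation as a real equation gives a root of `Cubic.toPoly` over `ℝ`. [folklore] -/
private theorem aeval_real_of_eq_d10904p {x : ℝ} (hx : x ^ 3 + (0) * x ^ 2 + (-17) * x + (-18) = 0) :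
    aeval x (Cubic.toPoly ⟨1, ((0 : ℤ) : ℚ), ((-17 : ℤ) : ℚ), ((-18 : ℤ) : ℚ)⟩) = 0 := by
  simp only [Cubic.toPoly, map_one, one_mul, aeval_add, aeval_mul, aeval_C, aeval_X_pow, aeval_X, eq_ratCast,
    Rat.cast_intCast]
  push_cast
  linear_combination hx

/-- **The three real embeddings of `ℚ(θ)`**, with located images (rational intervals of width `10⁻14`; IVT + lifting).
[cite: Cohen1993, §4.1.3 (real roots and signatures)] -/
theorem exists_three_ringHom_adjoin_d10904p (hθ : aeval θ (Cubic.toPoly ⟨1, ((0 : ℤ) : ℚ), ((-17 : ℤ) : ℚ), ((-18 : ℤ) : ℚ)⟩) = 0) :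
    ∃ (ρ₀ ρ₁ ρ₂ : ↥ℚ⟮θ⟯ →+* ℝ) (x0 x1 x2 : ℝ),
      ρ₀ (AdjoinSimple.gen ℚ θ) = x0 ∧ ρ₁ (AdjoinSimple.gen ℚ θ) = x1 ∧ ρ₂ (AdjoinSimple.gen ℚ θ) = x2 ∧
      ((-171380660502419 : ℝ) / 50000000000000) < x0 ∧ x0 < ((-342761321004837 : ℝ) / 100000000000000) ∧
      ((-114776652207329 : ℝ) / 100000000000000) < x1 ∧ x1 < ((-3586770381479 : ℝ) / 3125000000000) ∧
      ((91507594642433 : ℝ) / 20000000000000) < x2 ∧ x2 < ((228768986606083 : ℝ) / 50000000000000) := by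
  obtain ⟨x0, hl0, hu0, hx0⟩ := exists_cubic_root_Ioo_of_neg_of_pos (p := (0 : ℝ)) (q := (-17)) (r := (-18))
    (l := (-171380660502419 / 50000000000000)) (u := (-342761321004837 / 100000000000000)) (by norm_num) (by norm_num) (by norm_num)
  obtain ⟨x1, hl1, hu1, hx1⟩ := exists_cubic_root_Ioo_of_pos_of_neg (p := (0 : ℝ)) (q := (-17)) (r := (-18))
    (l := (-114776652207329 / 100000000000000)) (u := (-3586770381479 / 3125000000000)) (by norm_num) (by norm_num) (by norm_num)
  obtain ⟨x2, hl2, hu2, hx2⟩ := exists_cubic_root_Ioo_of_neg_of_pos (p := (0 : ℝ)) (q := (-17)) (r := (-18))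
    (l := (91507594642433 / 20000000000000)) (u := (228768986606083 / 50000000000000)) (by norm_num) (by norm_num) (by norm_num)
  obtain ⟨ρ₀, hρ₀⟩ := exists_ringHom_adjoin_apply_gen_eq (P := ⟨1, ((0 : ℤ) : ℚ), ((-17 : ℤ) : ℚ), ((-18 : ℤ) : ℚ)⟩) rfl
    irreducible_cubic_d10904p hθ (aeval_real_of_eq_d10904p hx0)
  obtain ⟨ρ₁, hρ₁⟩ := exists_ringHom_adjoin_apply_gen_eq (P := ⟨1, ((0 : ℤ) : ℚ), ((-17 : ℤ) : ℚ), ((-18 : ℤ) : ℚ)⟩) rfl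
    irreducible_cubic_d10904p hθ (aeval_real_of_eq_d10904p hx1)
  obtain ⟨ρ₂, hρ₂⟩ := exists_ringHom_adjoin_apply_gen_eq (P := ⟨1, ((0 : ℤ) : ℚ), ((-17 : ℤ) : ℚ), ((-18 : ℤ) : ℚ)⟩) rfl
    irreducible_cubic_d10904p hθ (aeval_real_of_eq_d10904p hx2)
  exact ⟨ρ₀, ρ₁, ρ₂, x0, x1, x2, hρ₀, hρ₁, hρ₂, hl0, hu0, hl1, hu1, hl2, hu2⟩

/-- **`ℚ(θ)` is TOTALLY REAL** (three distinct real embeddings, degree `3`). [cite: Cohen1993, §4.1.3] -/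
theorem isTotallyReal_adjoin_d10904p (hθ : aeval θ (Cubic.toPoly ⟨1, ((0 : ℤ) : ℚ), ((-17 : ℤ) : ℚ), ((-18 : ℤ) : ℚ)⟩) = 0) :
    haveI : FiniteDimensional ℚ ↥ℚ⟮θ⟯ :=
      IntermediateField.adjoin.finiteDimensional ⟨_, Cubic.monic_of_a_eq_one', by rwa [← aeval_def]⟩
    haveI : NumberField ↥ℚ⟮θ⟯ := NumberField.mk
    IsTotallyReal ↥ℚ⟮θ⟯ := by
  haveI : FiniteDimensional ℚ ↥ℚ⟮θ⟯ :=
      IntermediateField.adjoin.finiteDimensional ⟨_, Cubic.monic_of_a_eq_one', by rwa [← aeval_def]⟩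
  haveI : NumberField ↥ℚ⟮θ⟯ := NumberField.mk
  have h3 : Module.finrank ℚ ↥ℚ⟮θ⟯ = 3 := finrank_adjoin_eq_three_of_irreducible irreducible_cubic_d10904p hθ
  obtain ⟨ρ₀, ρ₁, ρ₂, x0, x1, x2, hρ₀, hρ₁, hρ₂, hl0, hu0, hl1, hu1, hl2, hu2⟩ := exists_three_ringHom_adjoin_d10904p hθ
  have hne : ∀ {φ ψ : ↥ℚ⟮θ⟯ →+* ℝ} {a c : ℝ}, φ (AdjoinSimple.gen ℚ θ) = a → ψ (AdjoinSimple.gen ℚ θ) = c → a ≠ c → φ ≠ ψ := by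
    intro φ ψ a c ha hc hac h; rw [h] at ha; exact hac (ha.symm.trans hc)
  have h01 : ρ₀ ≠ ρ₁ := hne hρ₀ hρ₁ (by intro h; linarith)
  have h02 : ρ₀ ≠ ρ₂ := hne hρ₀ hρ₂ (by intro h; linarith)
  have h12 : ρ₁ ≠ ρ₂ := hne hρ₁ hρ₂ (by intro h; linarith)
  refine isTotallyReal_of_three_realEmbeddings h3 ![ρ₀, ρ₁, ρ₂] ?_
  intro a c hac
  fin_cases a <;> fin_cases c <;> simp_all

end Embeddings

/-! ## `h(ℚ(θ))` odd and the one-bit certificate (`2 ∤ h(ℚ(θ, √2))`) -/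

section TwoAdic

variable {θ : AlgebraicClosure ℚ}

/-- `h(ℚ(θ))` is odd (the norm certificate `odd_classNumber_of_root_d10904p` at `ℚ(θ)`). -/
theorem odd_classNumber_adjoin_d10904p (hθ : aeval θ (Cubic.toPoly ⟨1, ((0 : ℤ) : ℚ), ((-17 : ℤ) : ℚ), ((-18 : ℤ) : ℚ)⟩) = 0) :
    haveI : FiniteDimensional ℚ ↥ℚ⟮θ⟯ :=
      IntermediateField.adjoin.finiteDimensional ⟨_, Cubic.monic_of_a_eq_one', by rwa [← aeval_def]⟩
    haveI : NumberField ↥ℚ⟮θ⟯ := NumberField.mk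
    Odd (classNumber ↥ℚ⟮θ⟯) := by
  haveI : FiniteDimensional ℚ ↥ℚ⟮θ⟯ :=
      IntermediateField.adjoin.finiteDimensional ⟨_, Cubic.monic_of_a_eq_one', by rwa [← aeval_def]⟩
  haveI : NumberField ↥ℚ⟮θ⟯ := NumberField.mk
  obtain ⟨b, -, hb⟩ := exists_ringOfIntegers_cubic_root (p := 0) (q := -17) (r := -18) hθ
  exact odd_classNumber_of_root_d10904p ↥ℚ⟮θ⟯ (finrank_adjoin_eq_three_of_irreducible irreducible_cubic_d10904p hθ) b hb

/-- **The one bit `e₁ = 0`: `2 ∤ h` of the first layer of every cyclotomic `ℤ₂`-extension of `ℚ(θ)`** (Chevalley's door at `2`,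
k4-w1 `layerOneBit_of_chevalleyCert`): `h(ℚ(θ))` odd, at most two primes above `2` (`4 ∤ g(0)`, `4 ∤ g(1)`), and the unit
`ε = (-97) + (-65)θ + (17)θ²` (`ε³ + (-287)ε² + (-12539)ε + (1) = 0`) has `ε ≡ 5 (mod 8)` under `θ ↦ z₂ ≡ 6` (`8 ∣ g(6)`, `g'(6)` odd):
a non-norm from `ℚ(θ, √2)`. KERNEL. [cite: Lang1990, Ch. 13 §4, Lemma 4.1] [cite: Washington1997, §13.1] -/
theorem layerOneBit_d10904p (hθ : aeval θ (Cubic.toPoly ⟨1, ((0 : ℤ) : ℚ), ((-17 : ℤ) : ℚ), ((-18 : ℤ) : ℚ)⟩) = 0) :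
    haveI : FiniteDimensional ℚ (IntermediateField.adjoin ℚ {θ}) :=
      IntermediateField.adjoin.finiteDimensional ((AlgebraicClosure.isAlgebraic ℚ).isAlgebraic θ).isIntegral
    haveI : NumberField (IntermediateField.adjoin ℚ {θ}) := NumberField.mk
    ∀ κL : ZpExtension (IntermediateField.adjoin ℚ {θ}) 2, κL.IsCyclotomic → classNumberPExp κL 1 = 0 := by
  have hθ' : θ ^ 3 + (0 : AlgebraicClosure ℚ) * θ ^ 2 + (-17 : AlgebraicClosure ℚ) * θ + (-18 : AlgebraicClosure ℚ) = 0 := by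
    have := hθ
    simp only [Cubic.toPoly, map_one, one_mul, aeval_add, aeval_mul, aeval_C, aeval_X_pow, aeval_X,
      eq_ratCast, Rat.cast_intCast] at this
    push_cast at this
    linear_combination this
  have he : aeval (algebraMap ℚ (AlgebraicClosure ℚ) (((-97 : ℤ) : ℚ) / ((1 : ℤ) : ℚ)) +
      algebraMap ℚ (AlgebraicClosure ℚ) (((-65 : ℤ) : ℚ) / ((1 : ℤ) : ℚ)) * θ +
      algebraMap ℚ (AlgebraicClosure ℚ) (((17 : ℤ) : ℚ) / ((1 : ℤ) : ℚ)) * θ ^ 2)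
      (Cubic.toPoly ⟨1, ((-287 : ℤ) : ℚ), ((-12539 : ℤ) : ℚ), ((1 : ℤ) : ℚ)⟩) = 0 := by
    simp only [Cubic.toPoly, map_one, one_mul, aeval_add, aeval_mul, aeval_C, aeval_X_pow, aeval_X, eq_ratCast,
      Rat.cast_intCast, Rat.cast_div]
    push_cast
    linear_combination ((133154 : AlgebraicClosure ℚ) + (131954 : AlgebraicClosure ℚ) * θ + (-56355 : AlgebraicClosure ℚ) * θ ^ 2 + (4913 : AlgebraicClosure ℚ) * θ ^ 3) * hθ'
  have hh := not_two_dvd_card_classGroup_adjoin_of_forall_cubicField_odd irreducible_cubic_d10904p (odd_classNumber_of_root_d10904p) hθ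
  exact layerOneBit_of_chevalleyCert irreducible_cubic_d10904p hθ hh ⟨0, by norm_num⟩ ⟨0, by norm_num⟩
    (-97) (-65) (17) (1) (-287) (-12539) (1) (by norm_num) he (6) (1) (by norm_num) (by norm_num) (by decide) (by decide)

end TwoAdic

end Summit.BirchSwinnertonDyer.BirchSwinnertonDyer.Theorems.AddKatoTwo

end
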